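import Mathlib
import Summits.ValiantsHypothesis.ValiantsHypothesis.Theorems.NewtonUnitEquationsDissociatedUniformTotalsLaw
import Summits.ValiantsHypothesis.ValiantsHypothesis.Theorems.NewtonUnitEquationsDissociatedUniformTotalsLawChartTops
import Literature.Computability.AlgebraicComplexity.NewtonPolygonTauProductBounds
import HarnessLib

/-!
# Crux `NewtonUnitEquations.DissociatedUniform` (stmt-ValiantsHypothesis-5905): totals law — the abstract chart sweep

The bookkeeping half of the separated ("third curve dominant") regime of the `n = 3` totals law (memo
`Cruxes/DissociatedUniform/NOTES-d1g3.md` §2 L5; start packet `NOTES-t1.md` §5(i)), stated for an ARBITRARY third curve `c` and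
abstract LOCALISATION DATA along one half-chart `w = (σ, t)`:
* for every position `z` a set of times `Y z` at which `c z` is the strict top of `C = c(G)` (the CORES; automatically pairwise
  time-ordered when `c` is injective, `ordered_of_subset_tops`), and
* a finite family of WINDOWS `W k` with allowed position sets `Z k` and per-window fibre-top bounds `n k`,
such that every exposed class word `a x + b (r - x) + c z` at time `t` has `t ∈ Y z` or `(t, z)` inside some window (`hcov`).
Then (`sum_card_chartTops_class_le`)
`∑_s #tops_σ(class s) ≤ ∑_r #tops_σ(P_r) + |G|² + |G| · ∑_k #(Z k) · n k`:
a class top at time `t` in the blob of position `z` is `c z +` the strict top of the fibre `P_{s-z}` at `t`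
(`isStrictTop_fibre_of_isStrictTop_class`), so class tops are charged to (position, fibre top) pairs
(`card_chartTops_class_le`); re-indexing `s ↦ s - z` and the kinetic counting tools of `…TotalsLawChartTops`
(`sum_card_chartTops_le` for the ordered cores, the window bounds for the rest) finish.  `totalVert_le_of_chart_bounds` adds the
two half-charts (`#tops₊ + #tops₋ ≤ #vert + 2` per fibre): `T ≤ V_P + 2|G| + M₊ + M₋`.
The companion file `…TotalsLawLargeThird` constructs the data for `μ • c`, `μ ≥ μ₀`.  No defs, no named facts; nothing here
bears on the law itself (OPEN) or on `VP ≠ VNP`.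
[folklore]
-/

set_option linter.dupNamespace false -- `ValiantsHypothesis.ValiantsHypothesis` (summit = problem) in every name

open scoped BigOperators
open Matrix Finset

namespace Summit.ValiantsHypothesis.ValiantsHypothesis.Theorems.NewtonUnitEquationsDissociatedUniform

namespace TotalsLaw

open Literature.Computability.AlgebraicComplexity.KPTT.PlanarMinkowski

variable {G : Type*} [AddCommGroup G] [Fintype G]

/-! ### Class tops are fibre tops -/

open Classical in
/-- A strict top of the class `r + z` lying in the blob of position `z`, i.e. the word `a x + b (r - x) + c z`, has its pair part
`a x + b (r - x)` as the strict top of the fibre `P_r` for the same weight. [folklore] -/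
theorem isStrictTop_fibre_of_isStrictTop_class (a b c : G → (Fin 2 → ℝ)) (w : Fin 2 → ℝ) (s r z x : G) (hs : r + z = s)
    (h : IsStrictTop w (Finset.univ.image fun p : G × G => a p.1 + b p.2 + c (s - p.1 - p.2)) (a x + b (r - x) + c z)) :
    IsStrictTop w (Finset.univ.image fun x' : G => a x' + b (r - x')) (a x + b (r - x)) := by
  refine ⟨Finset.mem_image.2 ⟨x, Finset.mem_univ _, rfl⟩, fun y hy hne => ?_⟩
  obtain ⟨x', -, rfl⟩ := Finset.mem_image.1 hy
  have hmem : a x' + b (r - x') + c z ∈ Finset.univ.image fun p : G × G => a p.1 + b p.2 + c (s - p.1 - p.2) :=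
    Finset.mem_image.2 ⟨(x', r - x'), Finset.mem_univ _, by rw [show s - x' - (r - x') = z by rw [← hs]; abel]⟩
  have hne' : a x' + b (r - x') + c z ≠ a x + b (r - x) + c z := fun heq => hne (add_right_cancel heq)
  have := h.lt hmem hne'
  rw [dotProduct_add w (a x' + b (r - x')), dotProduct_add w (a x + b (r - x))] at this
  linarith

/-! ### One class: charging tops to (position, fibre top) pairs -/

open Classical in
/-- **Charging.**  Given localisation data (`Y`, windows `W k` with allowed positions `Z k`) covering every exposed word of the
class `s` along the half-chart `σ`, the number of chart tops of the class is at most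
`∑_z #tops(P_{s-z}, Y z) + ∑_k ∑_{z ∈ Z k} #tops(P_{s-z}, W k)`. [folklore] -/
theorem card_chartTops_class_le (a b c : G → (Fin 2 → ℝ)) (σ : ℝ) (s : G) (Y : G → Set ℝ) {K : Type*} (KS : Finset K)
    (W : K → Set ℝ) (Z : K → Finset G)
    (hcov : ∀ (t : ℝ) (x r z : G), r + z = s →
      IsStrictTop ![σ, t] (Finset.univ.image fun p : G × G => a p.1 + b p.2 + c (s - p.1 - p.2)) (a x + b (r - x) + c z) →
      t ∈ Y z ∨ ∃ k ∈ KS, t ∈ W k ∧ z ∈ Z k) :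
    ((Finset.univ.image fun p : G × G => a p.1 + b p.2 + c (s - p.1 - p.2)).filter fun v =>
        ∃ t, IsStrictTop ![σ, t] (Finset.univ.image fun p : G × G => a p.1 + b p.2 + c (s - p.1 - p.2)) v).card ≤
      ∑ z, ((Finset.univ.image fun x : G => a x + b (s - z - x)).filter fun p =>
          ∃ t ∈ Y z, IsStrictTop ![σ, t] (Finset.univ.image fun x : G => a x + b (s - z - x)) p).card +
      ∑ k ∈ KS, ∑ z ∈ Z k, ((Finset.univ.image fun x : G => a x + b (s - z - x)).filter fun p =>
          ∃ t ∈ W k, IsStrictTop ![σ, t] (Finset.univ.image fun x : G => a x + b (s - z - x)) p).card := by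
  classical
  set F := Finset.univ.image fun p : G × G => a p.1 + b p.2 + c (s - p.1 - p.2) with hF
  set P : G → Finset (Fin 2 → ℝ) := fun r => Finset.univ.image fun x : G => a x + b (r - x) with hP
  set A : G → Finset (Fin 2 → ℝ) := fun z =>
    ((P (s - z)).filter fun p => ∃ t ∈ Y z, IsStrictTop ![σ, t] (P (s - z)) p).image fun p => p + c z with hA
  set B : K → G → Finset (Fin 2 → ℝ) := fun k z =>
    ((P (s - z)).filter fun p => ∃ t ∈ W k, IsStrictTop ![σ, t] (P (s - z)) p).image fun p => p + c z with hB
  have hsub : (F.filter fun v => ∃ t, IsStrictTop ![σ, t] F v) ⊆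
      Finset.univ.biUnion A ∪ KS.biUnion fun k => (Z k).biUnion (B k) := by
    intro v hv
    obtain ⟨hvF, t, htop⟩ := Finset.mem_filter.1 hv
    obtain ⟨⟨x, y⟩, -, hxy⟩ := Finset.mem_image.1 hvF
    -- the word `(x, y, z)`, `r = x + y`, `z = s - r`
    set r := x + y with hr
    set z := s - x - y with hz
    have hs : r + z = s := by rw [hr, hz]; abel
    have hy : y = r - x := by rw [hr]; abel
    have hv' : v = a x + b (r - x) + c z := by rw [← hxy, ← hy]
    have hsz : s - z = r := by rw [← hs]; abel
    rw [hv'] at htop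
    have hfib := isStrictTop_fibre_of_isStrictTop_class a b c _ s r z x hs htop
    rw [Finset.mem_union, Finset.mem_biUnion, Finset.mem_biUnion]
    rcases hcov t x r z hs htop with ht | ⟨k, hk, htk, hzk⟩
    · refine Or.inl ⟨z, Finset.mem_univ _, ?_⟩
      rw [hA, Finset.mem_image]
      refine ⟨a x + b (r - x), Finset.mem_filter.2 ⟨?_, t, ht, ?_⟩, hv'.symm⟩
      · rw [hsz]; exact Finset.mem_image.2 ⟨x, Finset.mem_univ _, rfl⟩
      · rw [hsz]; exact hfib
    · refine Or.inr ⟨k, hk, Finset.mem_biUnion.2 ⟨z, hzk, ?_⟩⟩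
      rw [hB, Finset.mem_image]
      refine ⟨a x + b (r - x), Finset.mem_filter.2 ⟨?_, t, htk, ?_⟩, hv'.symm⟩
      · rw [hsz]; exact Finset.mem_image.2 ⟨x, Finset.mem_univ _, rfl⟩
      · rw [hsz]; exact hfib
  refine (Finset.card_le_card hsub).trans ((Finset.card_union_le _ _).trans (add_le_add ?_ ?_))
  · refine Finset.card_biUnion_le.trans (Finset.sum_le_sum fun z _ => ?_)
    rw [hA]
    exact Finset.card_image_le
  · refine Finset.card_biUnion_le.trans (Finset.sum_le_sum fun k _ => ?_)
    refine Finset.card_biUnion_le.trans (Finset.sum_le_sum fun z _ => ?_)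
    rw [hB]
    exact Finset.card_image_le

/-! ### Cores are time-ordered -/

/-- Time sets on which two DIFFERENT points are strict tops are ordered in time (interval fibres). [folklore] -/
theorem ordered_of_subset_tops {σ : ℝ} {C : Finset (Fin 2 → ℝ)} {u u' : Fin 2 → ℝ} (hne : u ≠ u') {Y Y' : Set ℝ}
    (hY : ∀ t ∈ Y, IsStrictTop ![σ, t] C u) (hY' : ∀ t ∈ Y', IsStrictTop ![σ, t] C u') :
    (∀ t ∈ Y, ∀ t' ∈ Y', t < t') ∨ (∀ t ∈ Y, ∀ t' ∈ Y', t' < t) := by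
  by_contra h
  push Not at h
  obtain ⟨⟨t₁, ht₁, t₁', ht₁', h₁⟩, ⟨t₂, ht₂, t₂', ht₂', h₂⟩⟩ := h
  -- `t₁' ≤ t₁` and `t₂ ≤ t₂'`
  rcases le_or_gt t₂ t₁' with h₃ | h₃
  · -- `t₂ ≤ t₁' ≤ t₁`: `u` is top at `t₁'`
    exact hne (((hY t₂ ht₂).of_between (hY t₁ ht₁) h₃ h₁).unique (hY' t₁' ht₁'))
  · -- `t₁' < t₂ ≤ t₂'`: `u'` is top at `t₂`
    exact hne ((hY t₂ ht₂).unique ((hY' t₁' ht₁').of_between (hY' t₂' ht₂') h₃.le h₂))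

/-! ### All classes: re-indexing and the kinetic counts -/

open Classical in
/-- **The abstract sweep bound.**  Along the half-chart `σ`, let `c` be injective, let the cores `Y z` consist of times at which
`c z` is the strict top of `C`, let the windows `W k` (`k ∈ KS`) see at most `n k` tops of every fibre, and let (cores ∪ windows)
cover every exposed class word.  Then
`∑_s #tops_σ(class s) ≤ ∑_r #tops_σ(P_r) + |G|·|G| + |G| · ∑_k #(Z k) · n k`. [folklore] -/
theorem sum_card_chartTops_class_le (a b c : G → (Fin 2 → ℝ)) (hc : Function.Injective c) (σ : ℝ) (Y : G → Set ℝ)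
    {K : Type*} (KS : Finset K) (W : K → Set ℝ) (Z : K → Finset G) (n : K → ℕ)
    (hY : ∀ z, ∀ t ∈ Y z, IsStrictTop ![σ, t] (Finset.univ.image c) (c z))
    (hcov : ∀ (s : G) (t : ℝ) (x r z : G), r + z = s →
      IsStrictTop ![σ, t] (Finset.univ.image fun p : G × G => a p.1 + b p.2 + c (s - p.1 - p.2)) (a x + b (r - x) + c z) →
      t ∈ Y z ∨ ∃ k ∈ KS, t ∈ W k ∧ z ∈ Z k)
    (hwin : ∀ k ∈ KS, ∀ r : G, ((Finset.univ.image fun x : G => a x + b (r - x)).filter fun p =>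
      ∃ t ∈ W k, IsStrictTop ![σ, t] (Finset.univ.image fun x : G => a x + b (r - x)) p).card ≤ n k) :
    ∑ s, ((Finset.univ.image fun p : G × G => a p.1 + b p.2 + c (s - p.1 - p.2)).filter fun v =>
        ∃ t, IsStrictTop ![σ, t] (Finset.univ.image fun p : G × G => a p.1 + b p.2 + c (s - p.1 - p.2)) v).card ≤
      ∑ r, ((Finset.univ.image fun x : G => a x + b (r - x)).filter fun p =>
          ∃ t, IsStrictTop ![σ, t] (Finset.univ.image fun x : G => a x + b (r - x)) p).card +
      Fintype.card G * Fintype.card G + Fintype.card G * ∑ k ∈ KS, (Z k).card * n k := by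
  classical
  set P : G → Finset (Fin 2 → ℝ) := fun r => Finset.univ.image fun x : G => a x + b (r - x) with hP
  -- per-class charging, summed
  set f : G → G → ℕ := fun z r => ((P r).filter fun p => ∃ t ∈ Y z, IsStrictTop ![σ, t] (P r) p).card with hf
  set g : K → G → ℕ := fun k r => ((P r).filter fun p => ∃ t ∈ W k, IsStrictTop ![σ, t] (P r) p).card with hg
  have hclass : ∀ s, ((Finset.univ.image fun p : G × G => a p.1 + b p.2 + c (s - p.1 - p.2)).filter fun v =>
      ∃ t, IsStrictTop ![σ, t] (Finset.univ.image fun p : G × G => a p.1 + b p.2 + c (s - p.1 - p.2)) v).card ≤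
      ∑ z, f z (s - z) + ∑ k ∈ KS, ∑ z ∈ Z k, g k (s - z) := fun s =>
    card_chartTops_class_le a b c σ s Y KS W Z (hcov s)
  refine (Finset.sum_le_sum fun s _ => hclass s).trans ?_
  rw [Finset.sum_add_distrib]
  -- re-index `s ↦ s - z`
  have hre1 : ∑ s, ∑ z, f z (s - z) = ∑ r, ∑ z, f z r := by
    rw [Finset.sum_comm]
    refine (Finset.sum_congr rfl fun z _ => ?_).trans Finset.sum_comm
    exact Equiv.sum_comp (Equiv.subRight z) (f z)
  have hre2 : ∑ s, ∑ k ∈ KS, ∑ z ∈ Z k, g k (s - z) = ∑ k ∈ KS, ∑ z ∈ Z k, ∑ r, g k r := by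
    rw [Finset.sum_comm]
    refine Finset.sum_congr rfl fun k _ => ?_
    rw [Finset.sum_comm]
    refine Finset.sum_congr rfl fun z _ => ?_
    exact Equiv.sum_comp (Equiv.subRight z) (g k)
  rw [hre1, hre2]
  refine add_le_add ?_ ?_
  · -- cores: ordered family, fibre by fibre
    have hfib : ∀ r, ∑ z, f z r ≤ ((P r).filter fun p => ∃ t, IsStrictTop ![σ, t] (P r) p).card + Fintype.card G := by
      intro r
      have h := sum_card_chartTops_le (Finset.univ : Finset G) Y σ (P r) fun z _ z' _ hzz' =>
        ordered_of_subset_tops (fun h => hzz' (hc h)) (hY z) (hY z')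
      rwa [Finset.card_univ] at h
    calc ∑ r, ∑ z, f z r ≤ ∑ r, (((P r).filter fun p => ∃ t, IsStrictTop ![σ, t] (P r) p).card + Fintype.card G) :=
          Finset.sum_le_sum fun r _ => hfib r
      _ = _ := by rw [Finset.sum_add_distrib, Finset.sum_const, Finset.card_univ, smul_eq_mul]
  · -- windows
    calc ∑ k ∈ KS, ∑ z ∈ Z k, ∑ r, g k r ≤ ∑ k ∈ KS, ∑ _z ∈ Z k, ∑ _r : G, n k :=
          Finset.sum_le_sum fun k hk => Finset.sum_le_sum fun z _ => Finset.sum_le_sum fun r _ => hwin k hk r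
      _ = Fintype.card G * ∑ k ∈ KS, (Z k).card * n k := by
          rw [Finset.mul_sum]
          refine Finset.sum_congr rfl fun k _ => ?_
          rw [Finset.sum_const, Finset.sum_const, Finset.card_univ, smul_eq_mul, smul_eq_mul]
          ring

/-! ### Adding the two half-charts -/

open Classical in
/-- `V_s ≤ #tops₊(class s) + #tops₋(class s)` (every hull vertex is a chart top). [folklore] -/
theorem classVert_le_card_chartTops_add (a b c : G → (Fin 2 → ℝ)) (s : G) :
    classVert a b c s ≤
      ((Finset.univ.image fun p : G × G => a p.1 + b p.2 + c (s - p.1 - p.2)).filter fun v =>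
        ∃ t, IsStrictTop ![1, t] (Finset.univ.image fun p : G × G => a p.1 + b p.2 + c (s - p.1 - p.2)) v).card +
      ((Finset.univ.image fun p : G × G => a p.1 + b p.2 + c (s - p.1 - p.2)).filter fun v =>
        ∃ t, IsStrictTop ![-1, t] (Finset.univ.image fun p : G × G => a p.1 + b p.2 + c (s - p.1 - p.2)) v).card := by
  classical
  set F := Finset.univ.image fun p : G × G => a p.1 + b p.2 + c (s - p.1 - p.2) with hF
  have hcoe : (F : Set (Fin 2 → ℝ)) = classPts a b c s := by
    rw [hF, Finset.coe_image, Finset.coe_univ, Set.image_univ]; rfl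
  unfold classVert
  rw [← hcoe, extremePoints_eq_coe_filter_charts F, Set.ncard_coe_finset, Finset.filter_or]
  exact Finset.card_union_le _ _

open Classical in
/-- `#tops₊(P_r) + #tops₋(P_r) ≤ V(P_r) + 2`. [folklore] -/
theorem card_chartTops_fibre_add_le (a b : G → (Fin 2 → ℝ)) (r : G) :
    ((Finset.univ.image fun x : G => a x + b (r - x)).filter fun p =>
        ∃ t, IsStrictTop ![1, t] (Finset.univ.image fun x : G => a x + b (r - x)) p).card +
      ((Finset.univ.image fun x : G => a x + b (r - x)).filter fun p =>
        ∃ t, IsStrictTop ![-1, t] (Finset.univ.image fun x : G => a x + b (r - x)) p).card ≤ fibreVert a b r + 2 := by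
  classical
  set P := Finset.univ.image fun x : G => a x + b (r - x) with hP
  have hcoe : (P : Set (Fin 2 → ℝ)) = fibrePts a b r := by
    rw [hP, Finset.coe_image, Finset.coe_univ, Set.image_univ]; rfl
  unfold fibreVert
  rw [← hcoe]
  exact card_chartTops_add_card_chartTops_le P

open Classical in
/-- **Two half-charts.**  Per-chart bounds `∑_s #tops_σ(class s) ≤ ∑_r #tops_σ(P_r) + M_σ` (`σ = ±1`) give
`T ≤ V_P + 2|G| + M₊ + M₋`. [folklore] -/
theorem totalVert_le_of_chart_bounds (a b c : G → (Fin 2 → ℝ)) (M₁ M₂ : ℕ)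
    (h₁ : ∑ s, ((Finset.univ.image fun p : G × G => a p.1 + b p.2 + c (s - p.1 - p.2)).filter fun v =>
        ∃ t, IsStrictTop ![1, t] (Finset.univ.image fun p : G × G => a p.1 + b p.2 + c (s - p.1 - p.2)) v).card ≤
      ∑ r, ((Finset.univ.image fun x : G => a x + b (r - x)).filter fun p =>
        ∃ t, IsStrictTop ![1, t] (Finset.univ.image fun x : G => a x + b (r - x)) p).card + M₁)
    (h₂ : ∑ s, ((Finset.univ.image fun p : G × G => a p.1 + b p.2 + c (s - p.1 - p.2)).filter fun v =>
        ∃ t, IsStrictTop ![-1, t] (Finset.univ.image fun p : G × G => a p.1 + b p.2 + c (s - p.1 - p.2)) v).card ≤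
      ∑ r, ((Finset.univ.image fun x : G => a x + b (r - x)).filter fun p =>
        ∃ t, IsStrictTop ![-1, t] (Finset.univ.image fun x : G => a x + b (r - x)) p).card + M₂) :
    totalVert a b c ≤ fibreTotal a b + 2 * Fintype.card G + M₁ + M₂ := by
  classical
  unfold totalVert fibreTotal
  calc ∑ s, classVert a b c s ≤ ∑ s, (((Finset.univ.image fun p : G × G => a p.1 + b p.2 + c (s - p.1 - p.2)).filter fun v =>
        ∃ t, IsStrictTop ![1, t] (Finset.univ.image fun p : G × G => a p.1 + b p.2 + c (s - p.1 - p.2)) v).card +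
      ((Finset.univ.image fun p : G × G => a p.1 + b p.2 + c (s - p.1 - p.2)).filter fun v =>
        ∃ t, IsStrictTop ![-1, t] (Finset.univ.image fun p : G × G => a p.1 + b p.2 + c (s - p.1 - p.2)) v).card) :=
        Finset.sum_le_sum fun s _ => classVert_le_card_chartTops_add a b c s
    _ ≤ (∑ r, ((Finset.univ.image fun x : G => a x + b (r - x)).filter fun p =>
          ∃ t, IsStrictTop ![1, t] (Finset.univ.image fun x : G => a x + b (r - x)) p).card + M₁) +
        (∑ r, ((Finset.univ.image fun x : G => a x + b (r - x)).filter fun p =>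
          ∃ t, IsStrictTop ![-1, t] (Finset.univ.image fun x : G => a x + b (r - x)) p).card + M₂) := by
        rw [Finset.sum_add_distrib]; exact add_le_add h₁ h₂
    _ = ∑ r, (((Finset.univ.image fun x : G => a x + b (r - x)).filter fun p =>
          ∃ t, IsStrictTop ![1, t] (Finset.univ.image fun x : G => a x + b (r - x)) p).card +
        ((Finset.univ.image fun x : G => a x + b (r - x)).filter fun p =>
          ∃ t, IsStrictTop ![-1, t] (Finset.univ.image fun x : G => a x + b (r - x)) p).card) + (M₁ + M₂) := by
        rw [Finset.sum_add_distrib]; ring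
    _ ≤ ∑ r, (fibreVert a b r + 2) + (M₁ + M₂) :=
        Nat.add_le_add_right (Finset.sum_le_sum fun r _ => card_chartTops_fibre_add_le a b r) _
    _ = ∑ r, fibreVert a b r + 2 * Fintype.card G + M₁ + M₂ := by
        rw [Finset.sum_add_distrib, Finset.sum_const, Finset.card_univ, smul_eq_mul]; ring

end TotalsLaw

end Summit.ValiantsHypothesis.ValiantsHypothesis.Theorems.NewtonUnitEquationsDissociatedUniform
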